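import Mathlib
import Summits.Ventures.FusionMHD.Models.SAlphaStableS25A14375M7Core0
import HarnessLib

/-!
# STABLE-POINT core at `((5 / 2), 23/16)`, piece 6 (`[4, 11/2]`): kernel-decided Taylor-model leaves ⇒ `F_6 > 0` and `amplitudeResidual (5 / 2) (23/16) F_6 F_6″ ≤ 0` on the piece ⇒ `EnergyDominatesOn` for its amplitude phase

LADDER-GRIDFUSION rung F3 («F3.BALLOON-sα-S25-A14375-STABLE-SIDE»: the SECOND-ROUND lower end at s = 5/2 (partner of model-7's (5/2, 25/16) witness)); gridfusion-model-7 g9, 2026-08-28 (g8's core lane).  Two `decide +kernel` calls (`OpModel.trig.pLeavesCheck`, scale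
`2^60`, Taylor degree 10, 12 leaves of half-width 1/16) and the lane's soundness theorem `OpSem.trig.pos_of_pLeavesCheck`
(Literature/Analysis/ValidatedNumerics/TaylorModelZeroCert); lit-4's `energyDominatesOn_of_amplitude` (BallooningSAlphaStableSide) turns the two
sign facts into energy domination by `amplitudePhase (5 / 2) (23/16) F_6 F_6′` on the piece.  MODELLED: `s–α` model; nothing about a device.
No `native_decide`.  Citations: Freidberg 2014 §12.6.2 (12.97) [Freidberg2014]; Makino–Berz 2003 Alg. 2 [MakinoBerz2003]; Hartman 2002 XI.6.2
[Hartman2002].  Everything here is [instance data].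
-/

open Literature.Analysis.ValidatedNumerics Literature.Analysis.ValidatedNumerics.PolyMP
open Literature.Analysis.ValidatedNumerics.NumericsMP Literature.Analysis.ValidatedNumerics.ExpPoly
open Literature.MathematicalPhysics.MHD.Ballooning
open Real Set

namespace Summit.Ventures.FusionMHD.Models

namespace SAlphaStableS25A14375M7

/-- KERNEL CHECK (residual leaves of piece 6). [instance data] -/
theorem st2514_res6_ok : OpModel.trig.pLeavesCheck st2514Prm (2 ^ 60) (st2514Prog H6 (Poly.deriv (Poly.deriv H6))) [] st2514Leaves6 = true := by
  decide +kernel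

/-- KERNEL CHECK (positivity leaves of piece 6). [instance data] -/
theorem st2514_pos6_ok : OpModel.trig.pLeavesCheck st2514Prm (2 ^ 60) (st2514PosProg H6) [] st2514Leaves6 = true := by
  decide +kernel

/-- The leaves tile `[4, 11/2]`. [instance data] -/
theorem st2514_tiles6 : tiles (4 : ℚ) (st2514Leaves6.map fun l => (l.e, l.k)) (11/2 : ℚ) = true := by
  decide +kernel

/-- **PIECE 6**: the phase of `F_6` dominates the `s–α` energy on `[4, 11/2]` at `(s, α) = ((5 / 2), 23/16)`. [instance data] -/
theorem st2514_dominates6 :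
    SAlpha.EnergyDominatesOn (5 / 2) (23 / 16) (SAlpha.amplitudePhase (5 / 2) (23 / 16) (Poly.eval H6) (Poly.eval (Poly.deriv H6)))
      (Icc (4 : ℝ) (11/2 : ℝ)) := by
  have h := st2514_dominates (lf := H6) (x := 4) (y := 11/2) (by norm_num) st2514_tiles6 st2514_res6_ok st2514_pos6_ok
  norm_num at h
  exact h

end SAlphaStableS25A14375M7

end Summit.Ventures.FusionMHD.Models
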